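import Summits.HodgeConjecture.HodgeConjecture.Theorems.F0P3SpectralPacketPresentationBridgeOn   -- ★ (N) FILE 3u″: the ★ originals + everything their proofs read (★ 3u∕3u-H (u1)–(u3)∕(uH1)–(uH3), ★ 3y `trOn`, ★ 3j, ★ 3n, ★ 3k tails)
import HarnessLib

/-!
# (N) FILE 3u‴ — THE PRESENTATION BRIDGES UNDER (TF-1)∕S₀ WITH THE UNRAMIFIED-MEMBER LAW (ℓ4) READ ONLY OFF `S₀` (F13 «JQ-RAM» WP1 (5), K9 lane: additive `_offS` siblings of ★ 3u″
# `F0P3SpectralPacketPresentationBridgeOn` :78 `prod_trPkt_locAll_comp_eq_off`, :128 `trOn_partner_eq_trSψ_mul_prod_of_eval_eq`, :227 `prod_endoTrPkt_locAll_comp_eq_off`)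
# (Rogawski §13.3 p. 201 l. 1–4; §14.2 (14.2.1) pp. 232–233; §14.6 p. 243; §13.7 pp. 210–212; §4.3 p. 44; FlathCorvallis1979 Thm. 3)

Cell `hodgecm-mathlib` (D-0151), F0∕P3 «U3-mult», crux H413 (`stmt-HodgeConjecture-24833`), route of record `HCCMUnconditional`; programme R90-TF, F13 «JQ-RAM» repair
(director M-159∕M-159b; heir LEAD F0P3a-plan (g22) T21-11 WP1 (5) «K9 chain», T21-13 (1) §3′ r2, T21-14 (1)(2); R90-TF LEAD K2E1-plan (g8) LEAD #38 F13-SCOPE memo 7a2d5558a063a1f1 +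
LEAD #39 (A) r2; ref4 (g13) R4-175 kernel cone «`PresentationBridgeOn`: `prod_endoTrPkt_locAll_comp_eq_off` ⇢ …; `prod_trPkt_locAll_comp_eq_off` ⇢ …; `trOn_partner_eq_trSψ_mul_prod_of_eval_eq`
→ `prod_trPkt_…off` (3 of its 4 heads)»).  Seat: S7 prover R90-C146-p01 (g2) (✋ WP1 (5), LH4 bus 2026-09-04T23:49Z).  PROOF lane (`--kind proof --supports stmt-HodgeConjecture-24833
--as helper`): theorems only; no `def`, no instance, no notation, no named fact, no `sorry`; never imports a `Cruxes/…/Lines` module; ★ 3u″ UNTOUCHED (rule 69: siblings).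

SCOPE OF THIS FILE = the three heads whose only law hypothesis moved by F13 is (KG1): their normalisation hypotheses `h1 : Q.fin.UnramTraceOneOff S₀ νsplit` ∕ `h1G :
ρ.imageG.UnramTraceOneOff S₀ νsplit` are the G-side (TF-1)∕S₀, ALREADY `S₀`-guarded (★ 3y), and their trace functional is ★ 3y `trOn S₀`.  The FOURTH head of ★ 3u″ (:293
`trH_partner_eq_trHSψ_mul_prod_of_eval_eq_off`, H-side, `h1 : ρ.UnramTraceOneH νH` GLOBAL, conclusion over ★ 3h `ρ.trH νH archTrH`) is NOT twinned here: by the finding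
«KH3′-H-TRACE» (LH4 bus 2026-09-05T00:0xZ) its (TF-1)-H hypothesis and its functional `trH` need the H-side analogue of ★ 3y (`UnramTraceOneHOff S₀`, `trHOn S₀`) first — a
separate file on the LEAD's word.

WHY (F13) and SHAPE.  (KG1′) `∀ v, Algebra.IsUnramifiedIn (𝓞 L) v.asIdeal → (𝔩 v).UnramLaw` is uninhabitable kit-wide at ramified `v` (J-RAM-3); every (ℓ4) read of these three
heads sits under `hvS : v ∉ S` with `hS₀ : S₀ ⊆ S` (★ :104, :260, :262, :283) ⇒ §3′ r2: `h4 : ∀ v ∉ S₀, (𝔩 v).UnramLaw` bound right AFTER `hψK`, reads `(h4 v)` ↦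
`(h4 v fun h => hvS (hS₀ h))`, the inner call of (u5′) re-pointed to `prod_trPkt_locAll_comp_eq_off_offS`; member admissibility `hadm` (= (KG3′), unguarded) and everything else
verbatim.  Caller: `h4 := fun v hv => hKG1′ v (hS v hv)`.

CONTENTS.  §1 `SpectralPacketG.prod_trPkt_locAll_comp_eq_off_offS` (u4′), `SpectralPacketG.trOn_partner_eq_trSψ_mul_prod_of_eval_eq_offS` (u5′) · §2
`SpectralPacketH.prod_endoTrPkt_locAll_comp_eq_off_offS` (uH4′).  Binder orders: (u4′)(uH4′) `… S₀ h1∕h1G hadm hgood hψK h4 hμK S hS₀ hram fS fT S″ …`; (u5′) `… S₀ h1 hind hadm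
hgood hψK h4 hμK S …`.

HONEST LABEL: count-neutral repair twins; they pay no socket and no citation and nothing on the counted path until the F13 window is BUILT.  HC_CM is proved only modulo the 7
printed citations (2 remaining named inputs: hLiu418 = stmt-HodgeConjecture-24832, h413 = stmt-HodgeConjecture-24833) until rung 0 closes; STANDING DEFECT M-159∕M-159b «JQ-RAM».

References: [Rogawski1990] §13.3 p. 201 l. 1–4, p. 203 l. 1–3; §14.2 (14.2.1) pp. 232–233; §14.3 p. 233; §14.6 p. 243 l. 9–17; §13.7 pp. 210–212; §13.1 Thm. 13.1.1 (2) p. 198; §4.3 p. 44.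
[FlathCorvallis1979] Thm. 3.  [CartierCorvallis1979] §IV.1 Cor. 4.1.
-/

set_option autoImplicit false
-- the mandated namespace repeats `HodgeConjecture.HodgeConjecture`, as in every `Theorems/*.lean` of this sub-problem
set_option linter.dupNamespace false

noncomputable section

open NumberField IsDedekindDomain MeasureTheory Filter
open scoped Matrix MatrixGroups

open Literature.NumberTheory Literature.NumberTheory.Automorphic Literature.NumberTheory.Automorphic.UnitaryGroup
open Literature.NumberTheory.Rogawski1990 Literature.NumberTheory.GaloisRepresentations
open Literature.RepresentationTheory.BorelWallach2000 Literature.RepresentationTheory.KonnoKonno2007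
open Summit.HodgeConjecture.HodgeConjecture.Cruxes.H413.F0P3InnerFormClassificationV6 (TestG TestH splitForm)
open Summit.HodgeConjecture.HodgeConjecture.Cruxes.H413.F0P3LocalPacketKit
open Summit.HodgeConjecture.HodgeConjecture.Cruxes.H413.F0P3ArchPacketKit
open Summit.HodgeConjecture.HodgeConjecture.Cruxes.H413.F0P3EigencharacterTransport
open Summit.HodgeConjecture.HodgeConjecture.Cruxes.H413.F0P3TraceFactorisationZeroBranch
open Summit.HodgeConjecture.HodgeConjecture.Cruxes.H413.F0P3SemilocalTestFunctionsOfRecord (TestS₀ toPureTensor locAll locAll_of_mem locAll_of_not_mem toPureTensor_isTest toPureTensor_arch)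
open Summit.HodgeConjecture.HodgeConjecture.Cruxes.H413.F0P3TestFunctionsOfRecord (Unr₀)

/-! ## §1 (u4′)(u5′) the `G` side, (ℓ4) off `S₀` [§14.6 p. 243; §13.7 pp. 210–212; (TF-1) p. 201] -/

namespace Summit.HodgeConjecture.HodgeConjecture.Cruxes.H413.F0P3SpectralPacket

open Summit.HodgeConjecture.HodgeConjecture.Cruxes.H413.F0P3GlobalPacket

variable {L : Type} [Field L] [NumberField L] [IsCMField L]

namespace SpectralPacketG

variable {H : Matrix (Fin 3) (Fin 3) L} {ι : L →+* ℂ} {T : GL (Fin 3) ℂ}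
  {hT : (T : Matrix (Fin 3) (Fin 3) ℂ)ᴴ * H.map ι * (T : Matrix (Fin 3) (Fin 3) ℂ) = Literature.Geometry.ComplexHyperbolic.BallModel.J}
  {𝔩 : ∀ v : HeightOneSpectrum (𝓞 ↥(maximalRealSubfield L)), LocalPacketKit L (splitForm L 3) v} {𝔞 : ArchPacketKit}
  {μ : Measure (adelicGroupData (↥(maximalRealSubfield L)) L (IsCMField.complexConj L) 3 (splitForm L 3)).automorphicQuotient}
  [SMulInvariantMeasure (adelicGroupData (↥(maximalRealSubfield L)) L (IsCMField.complexConj L) 3 (splitForm L 3)).Adelic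
    (adelicGroupData (↥(maximalRealSubfield L)) L (IsCMField.complexConj L) 3 (splitForm L 3)).automorphicQuotient μ]
  [∀ v : HeightOneSpectrum (𝓞 ↥(maximalRealSubfield L)), MeasurableSpace ((cmDatum L 3 (splitForm L 3)).Local v)]
  [∀ v : HeightOneSpectrum (𝓞 ↥(maximalRealSubfield L)), BorelSpace ((cmDatum L 3 (splitForm L 3)).Local v)]
  [∀ v : HeightOneSpectrum (𝓞 ↥(maximalRealSubfield L)), MeasurableSpace ((cmDatum L 3 H).Local v)]
  [∀ v : HeightOneSpectrum (𝓞 ↥(maximalRealSubfield L)), BorelSpace ((cmDatum L 3 H).Local v)]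
  {νG' : ∀ v : HeightOneSpectrum (𝓞 ↥(maximalRealSubfield L)), Measure ((cmDatum L 3 H).Local v)}
  [∀ v, (νG' v).IsMulLeftInvariant] [∀ v, IsFiniteMeasureOnCompacts (νG' v)]
  {archTrG : GKIrrClass (uFormGroup (Fin 2) (Fin 1)) → (UnitaryGroup.arch (↥(maximalRealSubfield L)) L (IsCMField.complexConj L) 3 (splitForm L 3) → ℂ) → ℂ}

/-- **(u4′), (ℓ4) READ ONLY OFF `S₀`** (twin of ★ 3u″ `prod_trPkt_locAll_comp_eq_off`; `h4 : ∀ v ∉ S₀, …` right after `hψK`) — ★ 3u (u4) under (TF-1)∕S₀ only — ★ 3k's tail over ANY `S″ ⊇ S ∪ supp f^S`: `∏_{v∈S″} Tr Π_v(locAll_v ∘ ψ_v⁻¹) = (∏_{v∈S} Tr Π_v(f′_v ∘ ψ_v⁻¹)) · ∏_{v ∈ supp f^S} vol′(K′_v) · evpG Π v (f^S_v)` — Satake at `supp f^S`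
(★ 3j), `Tr Π_v(𝟙_{K_v}) = 1` at the other places of `S″` — all OUTSIDE `S ⊇ S₀`, so (TF-1)∕S₀ `UnramTraceOneOff S₀` suffices (`ψ_v(K′_v) = K_v` off `S₀ ⊆ S`). [cite: Rogawski1990, §14.6 p. 243; §13.7 pp. 210–212; §13.3 p. 201] [cite: CartierCorvallis1979, §IV.1 Cor. 4.1] -/
theorem prod_trPkt_locAll_comp_eq_off_offS (Q : SpectralPacketG 𝔩 𝔞 μ)
    (ψ : ∀ v : HeightOneSpectrum (𝓞 ↥(maximalRealSubfield L)), (cmDatum L 3 H).Local v ≃ₜ* (cmDatum L 3 (splitForm L 3)).Local v)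
    (S₀ : Finset (HeightOneSpectrum (𝓞 ↥(maximalRealSubfield L))))
    (h1 : Q.fin.UnramTraceOneOff S₀ fun v => (νG' v).map (ψ v))
    (hadm : ∀ (v : HeightOneSpectrum (𝓞 ↥(maximalRealSubfield L))), ∀ π ∈ (𝔩 v).mem (Q.fin.loc v), π.IsAdmissible)
    (hgood : ∀ v ∉ S₀, ∀ r : SmoothIrrep ((UnitaryGroup.cmDatum L 3 (splitForm L 3)).Local v), r.ρ.IsAdmissible →
      Module.finrank ℂ (r.ρ.fixedPoints (cmLocalIntegralLevel L 3 (splitForm L 3) v)) ≤ 1)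
    (hψK : ∀ v ∉ S₀, (cmLocalIntegralLevel L 3 H v).map (ψ v : (cmDatum L 3 H).Local v →* (cmDatum L 3 (splitForm L 3)).Local v) =
      cmLocalIntegralLevel L 3 (splitForm L 3) v)
    (h4 : ∀ v ∉ S₀, (𝔩 v).UnramLaw)
    (hμK : ∀ v : HeightOneSpectrum (𝓞 ↥(maximalRealSubfield L)), (νG' v).real (cmLocalIntegralLevel L 3 H v : Set ((cmDatum L 3 H).Local v)) ≠ 0)
    (S : Finset (HeightOneSpectrum (𝓞 ↥(maximalRealSubfield L)))) (hS₀ : S₀ ⊆ S) (hram : Q.fin.ramFinset ⊆ S)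
    (fS : TestS₀ L H ι T hT S) (fT : Unr₀ L H S)
    (S'' : Finset (HeightOneSpectrum (𝓞 ↥(maximalRealSubfield L)))) (hSS'' : S ⊆ S'') (hTS'' : fT.T ⊆ S'') :
    ∏ v ∈ S'', (𝔩 v).trPkt ((νG' v).map (ψ v)) (Q.fin.loc v) (locAll fS fT v ∘ (ψ v).symm) =
      (∏ v ∈ S, (𝔩 v).trPkt ((νG' v).map (ψ v)) (Q.fin.loc v) (locAll fS fT v ∘ (ψ v).symm)) *
        ∏ v ∈ fT.T, (((νG' v).real (cmLocalIntegralLevel L 3 H v : Set ((cmDatum L 3 H).Local v)) : ℂ) *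
          Q.evpGψ ψ (fun w => (νG' w).map (ψ w)) v (fT.loc v)) := by
  classical
  have hS'' : S ∪ fT.T ⊆ S'' := Finset.union_subset hSS'' hTS''
  rw [← Finset.prod_subset hS'' fun v _ hv => ?_]
  · rw [Finset.prod_union (Finset.disjoint_iff_ne.2 fun a ha b hb hab => Finset.disjoint_left.1 fT.hT hb (hab ▸ ha))]
    congr 1
    refine Finset.prod_congr rfl fun v hv => ?_
    have hvS : v ∉ S := fun h => Finset.disjoint_left.1 fT.hT hv h
    rw [locAll_of_not_mem fS fT hvS, Q.evpGψ_eq_evpAtψ]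
    exact Q.fin.trPkt_loc_comp_eq_measureReal_mul_evpAtψ ψ νG' (h4 v fun h => hvS (hS₀ h)) (hadm v) (hgood v fun h => hvS (hS₀ h)) (hψK v fun h => hvS (hS₀ h))
      (hμK v) (fun h => hvS (hram h)) (fT.hcs v) (fT.hlev v)
  · have hvS : v ∉ S := fun h => hv (Finset.mem_union_left _ h)
    have hvT : v ∉ fT.T := fun h => hv (Finset.mem_union_right _ h)
    rw [locAll_of_not_mem fS fT hvS, fT.loc_eq v hvT]
    have hind1 : (((cmLocalIntegralLevel L 3 H v : Set ((cmDatum L 3 H).Local v)).indicator fun _ => (1 : ℂ)) ∘ (ψ v).symm) =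
        (cmLocalIntegralLevel L 3 (splitForm L 3) v : Set ((cmDatum L 3 (splitForm L 3)).Local v)).indicator fun _ => 1 := by
      funext g
      simp only [Function.comp_apply]
      rw [← hψK v fun h => hvS (hS₀ h)]
      by_cases hg : (ψ v).symm g ∈ (cmLocalIntegralLevel L 3 H v : Set ((cmDatum L 3 H).Local v))
      · rw [Set.indicator_of_mem hg, Set.indicator_of_mem]
        exact ⟨(ψ v).symm g, hg, (ψ v).apply_symm_apply g⟩
      · rw [Set.indicator_of_notMem hg, Set.indicator_of_notMem]
        rintro ⟨k, hk, hkg⟩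
        exact hg (by rw [← hkg]; simpa using hk)
    rw [hind1]
    exact h1 v (fun h => hvS (hS₀ h)) (Q.fin.unr_of_not_mem_ramFinset fun h => hvS (hram h))

/-- **(u5′) (P1)-G AT THE TUPLE FOR THE PIN-PRESENTED PARTNER, READ BY `trOn S₀`, (ℓ4) READ ONLY OFF `S₀`** (twin of ★ 3u″ `trOn_partner_eq_trSψ_mul_prod_of_eval_eq`; `h4 : ∀ v ∉ S₀, …` right after `hψK`) (= ★ 3u (u5) with (TF-1)∕S₀ `UnramTraceOneOff S₀`, (TF-ind)∕S₀ `PresentationIndepOn S₀` and the conclusion on ★ 3y `Q.trOn S₀`; every use of (TF-1) is at a place outside `S″ ⊇ S ⊇ S₀` resp. outside `S`) — ★ 3m `tr_partner_eq_trSψ_mul_prod_of_innerTransferLawTest` with the record-tensor hypotheses replaced by pin (ix′)'s shape: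
`T₁` a TEST tensor on `G′` with `T₁.eval = (toPureTensor S fS fT).eval` (= `⇑(tens₀ S fS fT)`, ★ `coe_tens₀`), `T′` a test tensor on `G` with `T′_v = (T₁)_v ∘ ψ_v⁻¹` and `T₁.arch ↦ T′.arch` an
archimedean inner transfer; then for `f = T′.eval`: `Tr Π(f) = trGS S Π f′_{S,∞} · ∏_{v ∈ supp f^S} vol′(K′_v)·evpG Π v (f^S_v)` — modulo (TF-1), (TF-ind), (ℓ4), member admissibility,
Gelfand off `S₀`, `ψ_v(K′_v) = K_v` off `S₀ ⊆ S`, Haar riders, the GUARDED law (m3) and homogeneity of `archTr′` (for ★ `archTr₀`: linear in `f`).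
[cite: Rogawski1990, §14.6 p. 243; §14.2 (14.2.1) pp. 232–233; §13.7 pp. 210–212; §13.3 p. 201 l. 1–4] [cite: FlathCorvallis1979, Thm. 3] -/
theorem trOn_partner_eq_trSψ_mul_prod_of_eval_eq_offS (Q : SpectralPacketG 𝔩 𝔞 μ)
    (ψ : ∀ v : HeightOneSpectrum (𝓞 ↥(maximalRealSubfield L)), (cmDatum L 3 H).Local v ≃ₜ* (cmDatum L 3 (splitForm L 3)).Local v)
    (S₀ : Finset (HeightOneSpectrum (𝓞 ↥(maximalRealSubfield L))))
    (h1 : Q.fin.UnramTraceOneOff S₀ fun v => (νG' v).map (ψ v)) (hind : Q.PresentationIndepOn S₀ (fun v => (νG' v).map (ψ v)) archTrG)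
    (hadm : ∀ (v : HeightOneSpectrum (𝓞 ↥(maximalRealSubfield L))), ∀ π ∈ (𝔩 v).mem (Q.fin.loc v), π.IsAdmissible)
    (hgood : ∀ v ∉ S₀, ∀ r : SmoothIrrep ((UnitaryGroup.cmDatum L 3 (splitForm L 3)).Local v), r.ρ.IsAdmissible →
      Module.finrank ℂ (r.ρ.fixedPoints (cmLocalIntegralLevel L 3 (splitForm L 3) v)) ≤ 1)
    (hψK : ∀ v ∉ S₀, (cmLocalIntegralLevel L 3 H v).map (ψ v : (cmDatum L 3 H).Local v →* (cmDatum L 3 (splitForm L 3)).Local v) =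
      cmLocalIntegralLevel L 3 (splitForm L 3) v)
    (h4 : ∀ v ∉ S₀, (𝔩 v).UnramLaw)
    (hμK : ∀ v : HeightOneSpectrum (𝓞 ↥(maximalRealSubfield L)), (νG' v).real (cmLocalIntegralLevel L 3 H v : Set ((cmDatum L 3 H).Local v)) ≠ 0)
    (S : Finset (HeightOneSpectrum (𝓞 ↥(maximalRealSubfield L)))) (hS₀ : S₀ ⊆ S) (hram : Q.fin.ramFinset ⊆ S)
    (fS : TestS₀ L H ι T hT S) (fT : Unr₀ L H S)
    {T₁ : UnitaryGroup.PureTensor L 3 H} (hT₁ : T₁.IsTest) (hTe : T₁.eval = (toPureTensor S fS fT).eval)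
    {T' : UnitaryGroup.PureTensor L 3 (splitForm L 3)} (hT' : T'.IsTest)
    (hloc : ∀ v : HeightOneSpectrum (𝓞 ↥(maximalRealSubfield L)), T'.loc v = T₁.loc v ∘ (ψ v).symm)
    {F : TestG L} (hF : ⇑F = T'.eval)
    (archTr' : GKIrrClass (uFormGroup (Fin 2) (Fin 1)) → (UnitaryGroup.arch (↥(maximalRealSubfield L)) L (IsCMField.complexConj L) 3 H → ℂ) → ℂ)
    (harch' : ∀ (c : GKIrrClass (uFormGroup (Fin 2) (Fin 1))) (k : ℂ) (f : UnitaryGroup.arch (↥(maximalRealSubfield L)) L (IsCMField.complexConj L) 3 H → ℂ),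
      archTr' c (k • f) = k * archTr' c f)
    (m' : letI : ∀ γ : UnitaryGroup.arch (↥(maximalRealSubfield L)) L (IsCMField.complexConj L) 3 H,
        MeasurableSpace (UnitaryGroup.arch (↥(maximalRealSubfield L)) L (IsCMField.complexConj L) 3 H ⧸
          Subgroup.centralizer ({γ} : Set (UnitaryGroup.arch (↥(maximalRealSubfield L)) L (IsCMField.complexConj L) 3 H))) := fun _ => borel _;
      OrbitalMeasureFamily (UnitaryGroup.arch (↥(maximalRealSubfield L)) L (IsCMField.complexConj L) 3 H))
    (m : letI : ∀ γ : UnitaryGroup.arch (↥(maximalRealSubfield L)) L (IsCMField.complexConj L) 3 (splitForm L 3),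
        MeasurableSpace (UnitaryGroup.arch (↥(maximalRealSubfield L)) L (IsCMField.complexConj L) 3 (splitForm L 3) ⧸
          Subgroup.centralizer ({γ} : Set (UnitaryGroup.arch (↥(maximalRealSubfield L)) L (IsCMField.complexConj L) 3 (splitForm L 3)))) := fun _ => borel _;
      OrbitalMeasureFamily (UnitaryGroup.arch (↥(maximalRealSubfield L)) L (IsCMField.complexConj L) 3 (splitForm L 3)))
    (hlaw : 𝔞.InnerTransferLawTest L H m' m archTrG archTr')
    (harch : letI : ∀ γ : UnitaryGroup.arch (↥(maximalRealSubfield L)) L (IsCMField.complexConj L) 3 H,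
        MeasurableSpace (UnitaryGroup.arch (↥(maximalRealSubfield L)) L (IsCMField.complexConj L) 3 H ⧸
          Subgroup.centralizer ({γ} : Set (UnitaryGroup.arch (↥(maximalRealSubfield L)) L (IsCMField.complexConj L) 3 H))) := fun _ => borel _
      letI : ∀ γ : UnitaryGroup.arch (↥(maximalRealSubfield L)) L (IsCMField.complexConj L) 3 (splitForm L 3),
        MeasurableSpace (UnitaryGroup.arch (↥(maximalRealSubfield L)) L (IsCMField.complexConj L) 3 (splitForm L 3) ⧸
          Subgroup.centralizer ({γ} : Set (UnitaryGroup.arch (↥(maximalRealSubfield L)) L (IsCMField.complexConj L) 3 (splitForm L 3)))) := fun _ => borel _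
      IsArchInnerTransfer L H m' m T₁.arch T'.arch) :
    Q.trOn S₀ (fun v => (νG' v).map (ψ v)) archTrG F =
      Q.trSψ ψ S (fun v => (νG' v).map (ψ v)) archTr' fS *
        ∏ v ∈ fT.T, (((νG' v).real (cmLocalIntegralLevel L 3 H v : Set ((cmDatum L 3 H).Local v)) : ℂ) * Q.evpGψ ψ (fun w => (νG' w).map (ψ w)) v (fT.loc v)) := by
  classical
  -- the product over a common finite set
  set S'' := T'.S ∪ (T₁.S ∪ (S ∪ fT.T)) with hS''def
  have hramS'' : Q.fin.ramFinset ⊆ S'' := fun v hv =>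
    Finset.mem_union_right _ (Finset.mem_union_right _ (Finset.mem_union_left _ (hram hv)))
  have hS₀S'' : S₀ ⊆ S'' := fun v hv => Finset.mem_union_right _ (Finset.mem_union_right _ (Finset.mem_union_left _ (hS₀ hv)))
  rw [Q.trOn_eq_of_isTest hind h1 hT' hF S'' Finset.subset_union_left hramS'' hS₀S'']
  -- archimedean factor: the GUARDED law at the test pair `(T₁.arch, T′.arch)`
  rw [hlaw Q.inf T₁.arch T'.arch ((archSmooth_arch_iff_isArchTest L 3 H T₁).2 hT₁.isArchTest)
    ((archSmooth_arch_iff_isArchTest L 3 (splitForm L 3) T').2 hT'.isArchTest) harch]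
  -- finite factors read on `G′_v` through the pin relation, then moved from `T₁` to the record tensor by (u3)
  rw [Finset.prod_congr rfl fun v _ => by rw [hloc v],
    Q.archTr_mul_prod_trPkt_eq_of_eval_eq ψ hadm archTr' harch' hT₁ (toPureTensor_isTest S fS fT) hTe S''
      (fun v hv => Finset.mem_union_right _ (Finset.mem_union_left _ hv))
      (fun v hv => Finset.mem_union_right _ (Finset.mem_union_right _ (by simpa using hv)))]
  -- evaluate at the record tensor: arch factor `fS.arch`, finite factors `locAll`, then ★ 3k's tail (u4)
  simp only [toPureTensor_arch, toPureTensor_loc_eq_locAll]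
  rw [Q.prod_trPkt_locAll_comp_eq_off_offS ψ S₀ h1 hadm hgood hψK h4 hμK S hS₀ hram fS fT S''
      (fun v hv => Finset.mem_union_right _ (Finset.mem_union_right _ (Finset.mem_union_left _ hv)))
      (fun v hv => Finset.mem_union_right _ (Finset.mem_union_right _ (Finset.mem_union_right _ hv))),
    Q.trSψ_eq, mul_assoc]
  congr 2
  rw [← Finset.prod_coe_sort S]
  exact Finset.prod_congr rfl fun v _ => by rw [locAll_of_mem fS fT v.2]

end SpectralPacketG

end Summit.HodgeConjecture.HodgeConjecture.Cruxes.H413.F0P3SpectralPacket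

/-! ## §2 (uH4′) the `H` side endoscopic tail, (ℓ4) off `S₀` [§14.6 p. 243 l. 9–17; Thm. 13.1.1 (2); §13.7 pp. 210–212] -/

namespace Summit.HodgeConjecture.HodgeConjecture.Cruxes.H413.F0P3SpectralPacket.SpectralPacketH

open Summit.HodgeConjecture.HodgeConjecture.Cruxes.H413.F0P3GlobalPacket
open Summit.HodgeConjecture.HodgeConjecture.Cruxes.H413.F0P3ArchPacketKit.ArchPacketKitH

open Summit.HodgeConjecture.HodgeConjecture.Cruxes.H413.F0P3GlobalPacket
open Summit.HodgeConjecture.HodgeConjecture.Cruxes.H413.F0P3ArchPacketKit.ArchPacketKitH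

variable {L : Type} [Field L] [NumberField L] [IsCMField L] {H : Matrix (Fin 3) (Fin 3) L} {ι : L →+* ℂ} {T : GL (Fin 3) ℂ}
  {hT : (T : Matrix (Fin 3) (Fin 3) ℂ)ᴴ * H.map ι * (T : Matrix (Fin 3) (Fin 3) ℂ) = Literature.Geometry.ComplexHyperbolic.BallModel.J}
  {𝔩 : ∀ v : HeightOneSpectrum (𝓞 ↥(maximalRealSubfield L)), LocalPacketKit L (splitForm L 3) v} {𝔞 : ArchPacketKit} {𝔞H : ArchPacketKitH 𝔞}
  {DiscH : GlobalPacketH 𝔩 → 𝔞H.PktInfH → Prop}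
  [∀ v : HeightOneSpectrum (𝓞 ↥(maximalRealSubfield L)), MeasurableSpace ((cmDatum L 3 (splitForm L 3)).Local v)]
  [∀ v : HeightOneSpectrum (𝓞 ↥(maximalRealSubfield L)), BorelSpace ((cmDatum L 3 (splitForm L 3)).Local v)]
  [∀ v : HeightOneSpectrum (𝓞 ↥(maximalRealSubfield L)), MeasurableSpace ((cmDatum L 3 H).Local v)]
  [∀ v : HeightOneSpectrum (𝓞 ↥(maximalRealSubfield L)), BorelSpace ((cmDatum L 3 H).Local v)]
  [∀ v : HeightOneSpectrum (𝓞 ↥(maximalRealSubfield L)), MeasurableSpace ((cmDatum L 2 (splitForm L 2)).Local v × (cmDatum L 1 (splitForm L 1)).Local v)]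
  [∀ v : HeightOneSpectrum (𝓞 ↥(maximalRealSubfield L)), BorelSpace ((cmDatum L 2 (splitForm L 2)).Local v × (cmDatum L 1 (splitForm L 1)).Local v)]
  {νG' : ∀ v : HeightOneSpectrum (𝓞 ↥(maximalRealSubfield L)), Measure ((cmDatum L 3 H).Local v)}
  [∀ v, (νG' v).IsMulLeftInvariant] [∀ v, IsFiniteMeasureOnCompacts (νG' v)]
  {νH : ∀ v : HeightOneSpectrum (𝓞 ↥(maximalRealSubfield L)), Measure ((cmDatum L 2 (splitForm L 2)).Local v × (cmDatum L 1 (splitForm L 1)).Local v)}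
  [∀ v, (νH v).IsMulLeftInvariant] [∀ v, IsFiniteMeasureOnCompacts (νH v)]
  {archTrH : 𝔞H.CinfH → (UnitaryGroup.arch (↥(maximalRealSubfield L)) L (IsCMField.complexConj L) 2 (splitForm L 2) × UnitaryGroup.arch (↥(maximalRealSubfield L)) L (IsCMField.complexConj L) 1 (splitForm L 1) → ℂ) → ℂ}

omit [∀ v : HeightOneSpectrum (𝓞 ↥(maximalRealSubfield L)), MeasurableSpace ((cmDatum L 2 (splitForm L 2)).Local v × (cmDatum L 1 (splitForm L 1)).Local v)]
  [∀ v : HeightOneSpectrum (𝓞 ↥(maximalRealSubfield L)), BorelSpace ((cmDatum L 2 (splitForm L 2)).Local v × (cmDatum L 1 (splitForm L 1)).Local v)] in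
/-- **(uH4′), (ℓ4) READ ONLY OFF `S₀`** (twin of ★ 3u″ `prod_endoTrPkt_locAll_comp_eq_off`; `h4 : ∀ v ∉ S₀, …` right after `hψK`) — ★ 3u-H (uH4) under (TF-1)∕S₀ for `Π(ρ)` only — ★ 3n's tail over ANY `S″ ⊇ S, ⊇ supp f^S`: `∏_{v∈S″} Σ^{endo} ρ_v(locAll_v ∘ ψ_v⁻¹) = (∏_{v∈S} Σ^{endo} ρ_v(f′_v ∘ ψ_v⁻¹)) · ∏_{v ∈ supp f^S} vol′(K′_v) · evpH ρ v (f^S_v)` — on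
bi-`K_v`-invariant arguments the endoscopic sum is `Tr Π(ρ)_v` (★ 3n `endoTrPkt_eq_trPkt_of_isLevel`), then Satake at `supp f^S` (★ 3j) and (TF-1)∕S₀ elsewhere (all such places lie outside `S ⊇ S₀`; `ψ_v(K′_v) = K_v` off `S₀ ⊆ S`).
[cite: Rogawski1990, §14.6 p. 243 l. 9–17; §13.1 Thm. 13.1.1 (2) p. 198; §13.7 pp. 210–212; §13.3 p. 203 l. 1–3] [cite: CartierCorvallis1979, §IV.1 Cor. 4.1] -/
theorem prod_endoTrPkt_locAll_comp_eq_off_offS (ρ : SpectralPacketH 𝔩 𝔞 𝔞H DiscH)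
    (ψ : ∀ v : HeightOneSpectrum (𝓞 ↥(maximalRealSubfield L)), (cmDatum L 3 H).Local v ≃ₜ* (cmDatum L 3 (splitForm L 3)).Local v)
    (S₀ : Finset (HeightOneSpectrum (𝓞 ↥(maximalRealSubfield L))))
    (h1G : ρ.imageG.UnramTraceOneOff S₀ fun v => (νG' v).map (ψ v))
    (hadm : ∀ (v : HeightOneSpectrum (𝓞 ↥(maximalRealSubfield L))), ∀ π ∈ (𝔩 v).mem (ρ.imageG.loc v), π.IsAdmissible)
    (hgood : ∀ v ∉ S₀, ∀ r : SmoothIrrep ((UnitaryGroup.cmDatum L 3 (splitForm L 3)).Local v), r.ρ.IsAdmissible →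
      Module.finrank ℂ (r.ρ.fixedPoints (cmLocalIntegralLevel L 3 (splitForm L 3) v)) ≤ 1)
    (hψK : ∀ v ∉ S₀, (cmLocalIntegralLevel L 3 H v).map (ψ v : (cmDatum L 3 H).Local v →* (cmDatum L 3 (splitForm L 3)).Local v) =
      cmLocalIntegralLevel L 3 (splitForm L 3) v)
    (h4 : ∀ v ∉ S₀, (𝔩 v).UnramLaw)
    (hμK : ∀ v : HeightOneSpectrum (𝓞 ↥(maximalRealSubfield L)), (νG' v).real (cmLocalIntegralLevel L 3 H v : Set ((cmDatum L 3 H).Local v)) ≠ 0)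
    (S : Finset (HeightOneSpectrum (𝓞 ↥(maximalRealSubfield L)))) (hS₀ : S₀ ⊆ S) (hram : ρ.ramFinsetH ⊆ S)
    (fS : TestS₀ L H ι T hT S) (fT : Unr₀ L H S)
    (S'' : Finset (HeightOneSpectrum (𝓞 ↥(maximalRealSubfield L)))) (hSS'' : S ⊆ S'') (hTS'' : fT.T ⊆ S'') :
    ∏ v ∈ S'', (𝔩 v).endoTrPkt ((νG' v).map (ψ v)) (ρ.fin.loc v) (locAll fS fT v ∘ (ψ v).symm) =
      (∏ v ∈ S, (𝔩 v).endoTrPkt ((νG' v).map (ψ v)) (ρ.fin.loc v) (locAll fS fT v ∘ (ψ v).symm)) *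
        ∏ v ∈ fT.T, (((νG' v).real (cmLocalIntegralLevel L 3 H v : Set ((cmDatum L 3 H).Local v)) : ℂ) *
          ρ.evpHψ ψ (fun w => (νG' w).map (ψ w)) v (fT.loc v)) := by
  classical
  have hS'' : S ∪ fT.T ⊆ S'' := Finset.union_subset hSS'' hTS''
  rw [← Finset.prod_subset hS'' fun v _ hv => ?_]
  · rw [Finset.prod_union (Finset.disjoint_iff_ne.2 fun a ha b hb hab => Finset.disjoint_left.1 fT.hT hb (hab ▸ ha))]
    congr 1
    refine Finset.prod_congr rfl fun v hv => ?_
    have hvS : v ∉ S := fun h => Finset.disjoint_left.1 fT.hT hv h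
    haveI : ((νG' v).map (ψ v)).IsMulLeftInvariant :=
      isMulLeftInvariant_map (ψ v : (cmDatum L 3 H).Local v →ₙ* (cmDatum L 3 (splitForm L 3)).Local v) (ψ v).continuous.measurable (ψ v).surjective
    haveI : IsFiniteMeasureOnCompacts ((νG' v).map (ψ v)) := Measure.IsFiniteMeasureOnCompacts.map (νG' v) (ψ v).toHomeomorph
    have hfe : HasCompactSupport (fT.loc v ∘ (ψ v).symm) ∧ IsLevel (cmLocalIntegralLevel L 3 (splitForm L 3) v) (fT.loc v ∘ (ψ v).symm) := by
      have h := (hasCompactSupport_and_isLevel_comp_iff (ψ v) (cmLocalIntegralLevel L 3 H v) (fT.loc v ∘ (ψ v).symm)).1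
        (by rw [comp_symm_comp]; exact ⟨fT.hcs v, fT.hlev v⟩)
      rwa [hψK v fun h => hvS (hS₀ h)] at h
    rw [locAll_of_not_mem fS fT hvS,
      (𝔩 v).endoTrPkt_eq_trPkt_of_isLevel ((νG' v).map (ψ v)) (h4 v fun h => hvS (hS₀ h)) (ρ.fin.loc v) (ρ.unr_xiH_of_not_mem_ramFinsetH fun h => hvS (hram h))
        (by rw [← ρ.imageG_loc v]; exact hadm v) (hgood v fun h => hvS (hS₀ h)) hfe.1 hfe.2, ← ρ.imageG_loc v]
    exact ρ.imageG.trPkt_loc_comp_eq_measureReal_mul_evpAtψ ψ νG' (h4 v fun h => hvS (hS₀ h)) (hadm v) (hgood v fun h => hvS (hS₀ h)) (hψK v fun h => hvS (hS₀ h))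
      (hμK v) (fun h => hvS (hram h)) (fT.hcs v) (fT.hlev v)
  · have hvS : v ∉ S := fun h => hv (Finset.mem_union_left _ h)
    have hvT : v ∉ fT.T := fun h => hv (Finset.mem_union_right _ h)
    haveI : ((νG' v).map (ψ v)).IsMulLeftInvariant :=
      isMulLeftInvariant_map (ψ v : (cmDatum L 3 H).Local v →ₙ* (cmDatum L 3 (splitForm L 3)).Local v) (ψ v).continuous.measurable (ψ v).surjective
    haveI : IsFiniteMeasureOnCompacts ((νG' v).map (ψ v)) := Measure.IsFiniteMeasureOnCompacts.map (νG' v) (ψ v).toHomeomorph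
    rw [locAll_of_not_mem fS fT hvS, fT.loc_eq v hvT]
    -- `𝟙_{K′_v} ∘ ψ_v⁻¹ = 𝟙_{K_v}`
    have hind1 : (((cmLocalIntegralLevel L 3 H v : Set ((cmDatum L 3 H).Local v)).indicator fun _ => (1 : ℂ)) ∘ (ψ v).symm) =
        (cmLocalIntegralLevel L 3 (splitForm L 3) v : Set ((cmDatum L 3 (splitForm L 3)).Local v)).indicator fun _ => 1 := by
      funext g
      simp only [Function.comp_apply]
      rw [← hψK v fun h => hvS (hS₀ h)]
      by_cases hg : (ψ v).symm g ∈ (cmLocalIntegralLevel L 3 H v : Set ((cmDatum L 3 H).Local v))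
      · rw [Set.indicator_of_mem hg, Set.indicator_of_mem]
        exact ⟨(ψ v).symm g, hg, (ψ v).apply_symm_apply g⟩
      · rw [Set.indicator_of_notMem hg, Set.indicator_of_notMem]
        rintro ⟨k, hk, hkg⟩
        exact hg (by rw [← hkg]; simpa using hk)
    have hKv := isCompact_isOpen_cmLocalIntegralLevel L 3 (splitForm L 3) v
    rw [hind1, (𝔩 v).endoTrPkt_eq_trPkt_of_isLevel ((νG' v).map (ψ v)) (h4 v fun h => hvS (hS₀ h)) (ρ.fin.loc v) (ρ.unr_xiH_of_not_mem_ramFinsetH fun h => hvS (hram h))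
        (by rw [← ρ.imageG_loc v]; exact hadm v) (hgood v fun h => hvS (hS₀ h)) (indicator_mem_schwartzBruhat hKv.2 hKv.1).2
        (IsLevel.indicator hKv.2 hKv.1), ← ρ.imageG_loc v]
    exact h1G v (fun h => hvS (hS₀ h)) (ρ.unr_xiH_of_not_mem_ramFinsetH fun h => hvS (hram h))

end Summit.HodgeConjecture.HodgeConjecture.Cruxes.H413.F0P3SpectralPacket.SpectralPacketH

end
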